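import Mathlib

/-!
# The digit method in `ℤ[√d]` stops at exponent `3/4` (residue-set cap `|R| ≤ b`)
(wall-breaker k8 for `stub_tangencySets`, crux `LevelOneGL2Designs`, stmt-MatrixMultiplication-14080; the
"dead-axis" certificate of AXIS.md for composite bases)

Ruzsa's digit construction in `ℤ√d` with base `b` and residue set `R ⊆ [0,b)²` (no two elements differing by
a square mod `b`, see `QuadraticLift.sqDiffFree_digitStep`) produces square-difference-free sets of
`(|R|·b²)^t` elements in boxes of area `b^{4t}`, i.e. of exponent `(1 + log_{b²}|R|)/2`.  This file shows
that the exponent never exceeds `3/4` for the bases the lift can use: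

* `card_residueSet_le` — if every rational integer is a square modulo `b` in `ℤ√d` (true whenever all prime
  factors of `b` are inert, since `𝔽_ℓ^× ⊆ (𝔽_{ℓ²}^×)²`; in general a decidable property of `(d, b)`), then
  every admissible residue set has `|R| ≤ b = √N(b)`.  Proof: clique · coclique ≤ order — the rational
  residues `{0, …, b-1}` form a clique of the square-difference graph of `ℤ√d/(b)`, and
  `(r, n) ↦ r + n (mod b)` is injective on `R × [0,b)`.
* `card_residueSet_le_sqrtTwo_fifteen` — the instance `d = 2`, `b = 15 = 3·5` (`ℤ[√2]/(15) ≅ 𝔽₉ × 𝔽₂₅`):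
  `|R| ≤ 15`, so the composite inert base gains nothing over the prime ones (confirmed as sharp by
  exhaustive search, `comp/sqfree_residues.py` of the seat: the maximum is exactly `15`).

Hence `|K| ≤ (b³)^t = (b^{4t})^{3/4}`: exponent `3/4` is the ceiling of the digit method in quadratic orders
with inert (or, more generally, "rationally quadratic-residue") bases, and `5/4 = 1/2 + 3/4` the ceiling of
the quadratic-order parabola lift fed by digits (`…QuadraticLiftExponent.lean`).  Over `ℤ` the analogous cap
`R(m) ≤ √m` is only known for prime `m` (Lewko 2015 found `R(205) = 12 < √205`).  Elementary; no definitions.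
-/

-- justification: the summit/problem path `MatrixMultiplication.MatrixMultiplication` is fixed by the
-- tree layout (D-0017), so the namespace necessarily repeats a component.
set_option linter.dupNamespace false

open Finset

namespace Summit.MatrixMultiplication.MatrixMultiplication.Theorems.LevelOneGL2Designs.QuadraticLift

variable {d : ℤ}

/-- **Residue-set cap (clique · coclique).**  If every rational integer is a square mod `b` in `ℤ√d`, an
admissible residue set `R` (no two elements differing by a square mod `b`; in particular its elements are
pairwise incongruent mod `b`) has at most `b` elements: `(r, n) ↦ r + n (mod b)`, `n ∈ [0,b)`, is injective
on `R × [0,b)` into the `b²` residues.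
[elementary] -/
theorem card_residueSet_le (b : ℕ) (hb : 0 < b)
    (hsq : ∀ n : ℤ, ∃ z : ℤ√d, ((b : ℤ) : ℤ√d) ∣ z * z - n)
    (R : Finset (ℤ√d))
    (hR : ∀ r ∈ R, ∀ r' ∈ R, ∀ z : ℤ√d, ((b : ℤ) : ℤ√d) ∣ z * z - (r - r') → r = r') :
    R.card ≤ b := by
  classical
  haveI : NeZero b := ⟨hb.ne'⟩
  -- `(r, n) ↦ (r.re + n, r.im) mod b`
  let f : ℤ√d × ℕ → ZMod b × ZMod b := fun x => (((x.1.re + x.2 : ℤ) : ZMod b), ((x.1.im : ℤ) : ZMod b))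
  have hinj : Set.InjOn f ↑(R ×ˢ range b) := by
    rintro ⟨r, n⟩ hx ⟨r', n'⟩ hx' h
    simp only [coe_product, Set.mem_prod, mem_coe, mem_range] at hx hx'
    simp only [f, Prod.mk.injEq] at h
    obtain ⟨h1, h2⟩ := h
    rw [ZMod.intCast_eq_intCast_iff_dvd_sub] at h1 h2
    -- `r - r' ≡ n' - n ≡ z²  (mod b)`
    obtain ⟨z, hz⟩ := hsq ((n' : ℤ) - n)
    rw [Zsqrtd.intCast_dvd] at hz
    simp only [Zsqrtd.re_sub, Zsqrtd.im_sub, Zsqrtd.re_intCast, Zsqrtd.im_intCast, sub_zero] at hz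
    have hrr : r = r' := by
      refine hR r hx.1 r' hx'.1 z ?_
      rw [Zsqrtd.intCast_dvd]
      simp only [Zsqrtd.re_sub, Zsqrtd.im_sub]
      constructor
      · have key : (z * z).re - (r.re - r'.re) =
            ((z * z).re - (n' - n)) + ((r'.re + n') - (r.re + n)) := by ring
        rw [key]
        exact dvd_add hz.1 h1
      · have key : (z * z).im - (r.im - r'.im) = (z * z).im + (r'.im - r.im) := by ring
        rw [key]
        exact dvd_add hz.2 h2
    subst hrr
    have hnn : (b : ℤ) ∣ (n' : ℤ) - n := by
      have key : (n' : ℤ) - n = (r.re + n') - (r.re + n) := by ring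
      rw [key]
      exact h1
    have hn0 : (n' : ℤ) - n = 0 := by
      refine Int.eq_zero_of_abs_lt_dvd hnn ?_
      rw [abs_lt]; constructor <;> omega
    have : n = n' := by omega
    rw [this]
  have hcard := card_le_card_of_injOn f (fun x _ => mem_univ (f x)) hinj
  rw [card_product, card_range, card_univ, Fintype.card_prod, ZMod.card] at hcard
  exact Nat.le_of_mul_le_mul_right hcard hb

/-- **Instance `ℤ[√2]/(15) ≅ 𝔽₉ × 𝔽₂₅`.**  Every rational integer is a square mod `15` in `ℤ[√2]` (both `3`
and `5` are inert), so admissible residue sets mod `15` have at most `15` elements: the composite base does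
not beat exponent `3/4`. [elementary] -/
theorem card_residueSet_le_sqrtTwo_fifteen (R : Finset (ℤ√2))
    (hR : ∀ r ∈ R, ∀ r' ∈ R, ∀ z : ℤ√2, ((15 : ℤ) : ℤ√2) ∣ z * z - (r - r') → r = r') :
    R.card ≤ 15 := by
  refine card_residueSet_le 15 (by norm_num) (fun n => ?_) R hR
  -- square roots of the rationals mod `15` in `ℤ[√2]`: a witness table `m ↦ (u, v)`, `u + v√2`
  let w : ZMod 15 → ZMod 15 × ZMod 15 :=
    ![(0, 0), (1, 0), (0, 1), (0, 3), (2, 0), (0, 5), (6, 0), (5, 6), (0, 2), (3, 0), (5, 0), (6, 5), (0, 6),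
      (5, 3), (3, 5)]
  have key : ∀ m : ZMod 15,
      (w m).1 * (w m).1 + 2 * (w m).2 * (w m).2 = m ∧ (w m).1 * (w m).2 + (w m).2 * (w m).1 = 0 := by
    decide
  obtain ⟨h1, h2⟩ := key (n : ZMod 15)
  refine ⟨⟨((w n).1.val : ℤ), ((w n).2.val : ℤ)⟩, ?_⟩
  rw [Zsqrtd.intCast_dvd]
  simp only [Zsqrtd.re_sub, Zsqrtd.im_sub, Zsqrtd.re_mul, Zsqrtd.im_mul, Zsqrtd.re_intCast,
    Zsqrtd.im_intCast, sub_zero]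
  constructor
  · rw [← ZMod.intCast_zmod_eq_zero_iff_dvd]
    push_cast
    simp only [ZMod.natCast_zmod_val]
    linear_combination h1
  · rw [← ZMod.intCast_zmod_eq_zero_iff_dvd]
    push_cast
    simp only [ZMod.natCast_zmod_val]
    linear_combination h2

end Summit.MatrixMultiplication.MatrixMultiplication.Theorems.LevelOneGL2Designs.QuadraticLift
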